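import Summits.QuantumFields.YangMills.Theorems.BalabanUVNodesN15KingModelCoverPureGauge
import HarnessLib

/-!
# BalabanUVNodes ∕ N15 — THE KING-MODEL RUNG (PART Ͻ-q): FINITE COVERS — THE HONEST BOUNDARY AS A THEOREM: plaquette holonomies of King's link fields are gauge COVARIANT and PULL BACK
# along every covering, a pure gauge has trivial plaquettes, so NO COVER AND NO GAUGE TRIVIALISE A FIELD WITH A NON-TRIVIAL PLAQUETTE — the cover method of PART Ͻ reaches exactly
# the flat sector; a CONSTANT-FLUX field (`U(x,ν₁) = χ_p(x)`, flux `χ_p(e_{ν₀})` through every `(ν₀,ν₁)`-plaquette) is an explicit witness outside it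
# (Track A, DAG node N15 = NE2; FAN-OUT v1.1 §N15 s3 «KING-MODEL RUNG … + what the curved case adds»; count-neutral)

HONEST FRAMING.  Count-neutral (cell `pub-ymgap`, seat `pub-ymgap-dag-n15-e` g45; `--supports stmt-QuantumFields-27247 --as helper` = K3ᴬ, KEY MAP v3).  Elementary lattice gauge
kinematics for the link fields of PART Ͱ (`Tor K × Fin (d+1) → Matrix n n 𝕜`, gauge action `kingGaugeAct`, [Balaban1985BackgroundPropagators] p.398 l.1–2); it records, as theorems, WHY PART Ͻ
(finite covers) stops at flat fields: door (t4⁴⁹) «constant flux = honest boundary» of the seat's §g44.  NOT Bałaban's `G_k(U)`; NOT a node discharge; nothing continuum ∕ ℝ⁴ ∕ OS ∕ Clay.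

PROVED HERE:
* §1 `kingPlaq` (def: `U(x,μ)U(x+e_μ,ν)U(x+e_ν,μ)^*U(x,ν)^*`), `kingPlaq_free` (`= 1`), ★★ **`kingPlaq_kingGaugeAct`** (`= g(x)·P_U(x)·g(x)^*` for unitary `g`), ★ `kingPlaq_pureGauge` (a gauge transform of the
  trivial field has all plaquettes `= 1`), `kingPlaq_toronLink` (torons are FLAT: all plaquettes `= 1`);
* §2 `pullLink` (def: `U ∘ π`), `pullLink_toronLink`, ★★ **`kingPlaq_pullLink`** (plaquettes pull back: `P_{U∘π}(x̃) = P_U(π x̃)`), ★★★ **`pullLink_ne_pureGauge_of_kingPlaq_ne_one`** (a non-trivial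
  plaquette downstairs ⇒ on NO cover is the pulled-back field a pure gauge) — THE BOUNDARY OF THE COVER METHOD;
* §3 THE CONSTANT-FLUX WITNESS: `fluxLink` (def: `U(x,ν₁) = χ_p(x)·1`, else `1`), `fluxLink_mem_unitaryGroup`, ★★ **`kingPlaq_fluxLink`** (flux `χ_p(e_{ν₀})` through every `(ν₀,ν₁)`-plaquette,
  `ν₀ ≠ ν₁`), `chi_unitVec_ne_one` (`p_{ν₀} ≠ 0 ⇒ χ_p(e_{ν₀}) ≠ 1`), ★★★ **`fluxLink_not_trivialised`** (for `p_{ν₀} ≠ 0`, `ν₀ ≠ ν₁`: on no cover is `fluxLink` a pure gauge — constant flux is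
  outside PART Ͻ's reach).
PRIOR TREE ART (by name): Ͱ-a (`kingGaugeAct`, `free_mem_unitaryGroup`), Ͷ-a (`toronLink`, `toronLink_apply`), Ͻ-b (`proj`, `proj_add_unitVec`), `B5Prop11Plancherel` (`chi`, `chi_add_right`,
`chi_unitVec`), Ͷ-c (`chi_mul_conj`), `LatticeDiamagneticInequality.Hopping.free`, Mathlib (`ZMod.injective_stdAddChar`, `Matrix.mem_unitaryGroup_iff`).  Dedup (rg at filing): basename 0
files; needles `kingPlaq|pullLink|fluxLink` 0 tree files (the tree's `FlatLatticeGaugeFields.plaquetteHolonomy` lives on the isotropic carrier `GaugeConfig d L G` — other carrier, cited).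
presearch: n/a (elementary).  Locators: [Balaban1985BackgroundPropagators] p.398 l.1–2 (gauge transformations), (3.3) p.391; [King1986] (2.12) p.653 (`U(γ(Γ)) = exp[ieA(Γ)]`, contour
holonomies); [tHooft1979Flux] NPB 153 (flux sectors, notion only).  0 `sorry`, 3 `def`.
-/

noncomputable section

open scoped BigOperators ComplexConjugate ComplexOrder
open Finset Matrix

namespace Summit.QuantumFields.YangMills.BalabanUVNodes.N15KingModelRung.Cover

open Literature.MathematicalPhysics.QuantumFieldTheory.LatticeDiamagneticInequality (Hopping)
open Literature.MathematicalPhysics.QuantumFieldTheory.Balaban1983to89.B5Prop11Plancherel (Tor unitVec chi chi_add_right chi_unitVec)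
open Summit.QuantumFields.YangMills.BalabanUVNodes.N15KingModelRung.Toron (toronLink toronLink_apply chi_mul_conj)
open Summit.QuantumFields.YangMills.BalabanUVNodes.N15KingModelRung.Covariant (kingGaugeAct free_mem_unitaryGroup)

variable {d : ℕ} (K : Fin (d + 1) → ℕ)
variable {𝕜 : Type*} [RCLike 𝕜] {n : Type*} [Fintype n] [DecidableEq n]

/-! ## §1 Plaquette holonomies: gauge covariance; pure gauges and torons are flat -/

/-- THE PLAQUETTE HOLONOMY of a link field at `x` in the `(μ,ν)` plane: `U(x,μ)·U(x+e_μ,ν)·U(x+e_ν,μ)^*·U(x,ν)^*` (for unitary fields `^* = ⁻¹`).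
[cite: King1986, (2.12) p.653; Balaban1985BackgroundPropagators, (3.3) p.391] -/
def kingPlaq (U : Tor K × Fin (d + 1) → Matrix n n 𝕜) (x : Tor K) (μ ν : Fin (d + 1)) : Matrix n n 𝕜 :=
  U (x, μ) * U (x + unitVec K μ, ν) * (U (x + unitVec K ν, μ))ᴴ * (U (x, ν))ᴴ

/-- The trivial field is flat: all plaquettes are `1`. [folklore] -/
theorem kingPlaq_free (x : Tor K) (μ ν : Fin (d + 1)) : kingPlaq K (Hopping.free : Tor K × Fin (d + 1) → Matrix n n 𝕜) x μ ν = 1 := by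
  simp [kingPlaq, Hopping.free]

/-- `gᴴ·g = 1` for unitary `g`. [folklore] -/
theorem conjTranspose_mul_self_of_mem {g : Matrix n n 𝕜} (hg : g ∈ Matrix.unitaryGroup n 𝕜) : gᴴ * g = 1 := by
  simpa only [star_eq_conjTranspose] using Matrix.mem_unitaryGroup_iff'.mp hg

/-- `g·gᴴ = 1` for unitary `g`. [folklore] -/
theorem mul_conjTranspose_self_of_mem {g : Matrix n n 𝕜} (hg : g ∈ Matrix.unitaryGroup n 𝕜) : g * gᴴ = 1 := by
  simpa only [star_eq_conjTranspose] using Matrix.mem_unitaryGroup_iff.mp hg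

/-- ★★ **GAUGE COVARIANCE OF THE PLAQUETTE**: `P_{U^g}(x) = g(x)·P_U(x)·g(x)^*` for a unitary-valued gauge transformation (`U^g(x,μ) = g(x)U(x,μ)g(x+e_μ)^*`).
[cite: Balaban1985BackgroundPropagators, p.398 l.1–2] -/
theorem kingPlaq_kingGaugeAct {g : Tor K → Matrix n n 𝕜} (hg : ∀ x, g x ∈ Matrix.unitaryGroup n 𝕜) (U : Tor K × Fin (d + 1) → Matrix n n 𝕜) (x : Tor K) (μ ν : Fin (d + 1)) :
    kingPlaq K (kingGaugeAct K g U) x μ ν = g x * kingPlaq K U x μ ν * (g x)ᴴ := by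
  simp only [kingPlaq, kingGaugeAct, Matrix.conjTranspose_mul, Matrix.conjTranspose_conjTranspose]
  have h1 := conjTranspose_mul_self_of_mem (hg (x + unitVec K μ))
  have h2 := conjTranspose_mul_self_of_mem (hg (x + unitVec K ν))
  have h3 := conjTranspose_mul_self_of_mem (hg (x + unitVec K μ + unitVec K ν))
  have hcomm : x + unitVec K ν + unitVec K μ = x + unitVec K μ + unitVec K ν := by abel
  rw [hcomm]
  calc g x * U (x, μ) * (g (x + unitVec K μ))ᴴ * (g (x + unitVec K μ) * U (x + unitVec K μ, ν) * (g (x + unitVec K μ + unitVec K ν))ᴴ)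
        * (g (x + unitVec K μ + unitVec K ν) * ((U (x + unitVec K ν, μ))ᴴ * (g (x + unitVec K ν))ᴴ)) * (g (x + unitVec K ν) * ((U (x, ν))ᴴ * (g x)ᴴ))
      = g x * U (x, μ) * ((g (x + unitVec K μ))ᴴ * g (x + unitVec K μ)) * U (x + unitVec K μ, ν) * ((g (x + unitVec K μ + unitVec K ν))ᴴ * g (x + unitVec K μ + unitVec K ν))
        * (U (x + unitVec K ν, μ))ᴴ * ((g (x + unitVec K ν))ᴴ * g (x + unitVec K ν)) * (U (x, ν))ᴴ * (g x)ᴴ := by simp only [Matrix.mul_assoc]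
    _ = g x * (U (x, μ) * U (x + unitVec K μ, ν) * (U (x + unitVec K ν, μ))ᴴ * (U (x, ν))ᴴ) * (g x)ᴴ := by
        rw [h1, h2, h3]; simp only [Matrix.mul_one, Matrix.mul_assoc]

/-- ★ **A PURE GAUGE IS FLAT**: every plaquette of `(free)^g` is `1` (unitary `g`). [cite: Balaban1985BackgroundPropagators, p.398 l.1–2] -/
theorem kingPlaq_pureGauge {g : Tor K → Matrix n n 𝕜} (hg : ∀ x, g x ∈ Matrix.unitaryGroup n 𝕜) (x : Tor K) (μ ν : Fin (d + 1)) :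
    kingPlaq K (kingGaugeAct K g (Hopping.free : Tor K × Fin (d + 1) → Matrix n n 𝕜)) x μ ν = 1 := by
  rw [kingPlaq_kingGaugeAct K hg, kingPlaq_free, Matrix.mul_one, mul_conjTranspose_self_of_mem (hg x)]

/-- TORONS ARE FLAT: every plaquette of the constant abelian field `U(x,μ) = ω_μ` is `1` (`|ω_μ| = 1`; the phases commute). [cite: Balaban1985BackgroundPropagators, (3.3) p.391] -/
theorem kingPlaq_toronLink {ω : Fin (d + 1) → ℂ} (hω : ∀ μ, ‖ω μ‖ = 1) (x : Tor K) (μ ν : Fin (d + 1)) : kingPlaq K (toronLink K ω) x μ ν = 1 := by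
  ext i j
  obtain rfl : i = () := rfl; obtain rfl : j = () := rfl
  simp only [kingPlaq, Matrix.mul_apply, Matrix.conjTranspose_apply, toronLink_apply, Fintype.univ_unit, Finset.sum_singleton, Matrix.one_apply_eq, Complex.star_def]
  have h1 : ω μ * conj (ω μ) = 1 := by rw [Complex.mul_conj', hω]; norm_num
  have h2 : ω ν * conj (ω ν) = 1 := by rw [Complex.mul_conj', hω]; norm_num
  calc ω μ * ω ν * conj (ω μ) * conj (ω ν) = (ω μ * conj (ω μ)) * (ω ν * conj (ω ν)) := by ring
    _ = 1 := by rw [h1, h2, mul_one]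

/-! ## §2 Plaquettes pull back along covers: no cover trivialises curvature -/

section Cover

variable {K} [hK : ∀ μ, NeZero (K μ)] {K' : Fin (d + 1) → ℕ}

/-- THE PULLED-BACK LINK FIELD on the cover: `(U ∘ π)(x̃, μ) = U(π x̃, μ)`. [folklore] -/
def pullLink (h : ∀ μ, K μ ∣ K' μ) (U : Tor K × Fin (d + 1) → Matrix n n 𝕜) : Tor K' × Fin (d + 1) → Matrix n n 𝕜 := fun b => U (proj h b.1, b.2)

/-- A toron pulls back to the same toron (constant fields). [folklore] -/
theorem pullLink_toronLink (h : ∀ μ, K μ ∣ K' μ) (ω : Fin (d + 1) → ℂ) : pullLink (n := Unit) h (toronLink K ω) = toronLink K' ω := by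
  funext b; rfl

omit [DecidableEq n] in
/-- ★★ **PLAQUETTES PULL BACK**: `P_{U∘π}(x̃; μ, ν) = P_U(π x̃; μ, ν)` — the covering projection is a local isomorphism of the lattice (`π(x̃ + e_μ) = π x̃ + e_μ`). [folklore] -/
theorem kingPlaq_pullLink (h : ∀ μ, K μ ∣ K' μ) (U : Tor K × Fin (d + 1) → Matrix n n 𝕜) (x : Tor K') (μ ν : Fin (d + 1)) :
    kingPlaq K' (pullLink h U) x μ ν = kingPlaq K U (proj h x) μ ν := by
  simp only [kingPlaq, pullLink, proj_add_unitVec]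

/-- ★★★ **THE BOUNDARY OF THE COVER METHOD**: if some plaquette of `U` is not `1`, then on NO covering torus `T_{K′} → T_K` is the pulled-back field a gauge transform of the trivial field
(by any unitary-valued `g`) — covers only unwind HOLONOMY, never CURVATURE. [cite: Balaban1985BackgroundPropagators, p.398 l.1–2; tHooft1979Flux, NPB 153 (flux sectors)] -/
theorem pullLink_ne_pureGauge_of_kingPlaq_ne_one (h : ∀ μ, K μ ∣ K' μ) {U : Tor K × Fin (d + 1) → Matrix n n 𝕜} {x : Tor K} {μ ν : Fin (d + 1)} (hP : kingPlaq K U x μ ν ≠ 1)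
    {g : Tor K' → Matrix n n 𝕜} (hg : ∀ y, g y ∈ Matrix.unitaryGroup n 𝕜) :
    pullLink h U ≠ kingGaugeAct K' g (Hopping.free : Tor K' × Fin (d + 1) → Matrix n n 𝕜) := by
  intro hEq
  obtain ⟨x', rfl⟩ := proj_surjective h x
  have h1 := kingPlaq_pullLink h U x' μ ν
  rw [hEq, kingPlaq_pureGauge K' hg] at h1
  exact hP h1.symm

/-- The same with the toron phrased as the target: a field with a non-trivial plaquette is not the pull-back image of any toron's gauge orbit on any cover (torons are flat).
[cite: Balaban1985BackgroundPropagators, (3.3) p.391] -/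
theorem kingPlaq_pullLink_ne_one (h : ∀ μ, K μ ∣ K' μ) {U : Tor K × Fin (d + 1) → Matrix n n 𝕜} {x : Tor K} {μ ν : Fin (d + 1)} (hP : kingPlaq K U x μ ν ≠ 1) :
    ∃ x' : Tor K', kingPlaq K' (pullLink h U) x' μ ν ≠ 1 := by
  obtain ⟨x', rfl⟩ := proj_surjective h x
  exact ⟨x', by rwa [kingPlaq_pullLink]⟩

end Cover

/-! ## §3 The constant-flux witness -/

variable [hK : ∀ μ, NeZero (K μ)]

/-- THE CONSTANT-FLUX FIELD (lattice Landau gauge): `U(x, ν₁) = χ_p(x)·1`, all other links trivial — on the torus automatically periodic. [cite: tHooft1979Flux, NPB 153 (flux sectors, notion); King1986, (2.12) p.653] -/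
def fluxLink (p : Tor K) (ν₁ : Fin (d + 1)) : Tor K × Fin (d + 1) → Matrix Unit Unit ℂ :=
  fun b => if b.2 = ν₁ then Matrix.of (fun _ _ => chi K p b.1) else 1

/-- Its links are unitary (`|χ| = 1`). [folklore] -/
theorem fluxLink_mem_unitaryGroup (p : Tor K) (ν₁ : Fin (d + 1)) (b : Tor K × Fin (d + 1)) : fluxLink K p ν₁ b ∈ Matrix.unitaryGroup Unit ℂ := by
  unfold fluxLink
  split_ifs with hb
  · refine Matrix.mem_unitaryGroup_iff.mpr ?_
    ext i j
    obtain rfl : i = () := rfl; obtain rfl : j = () := rfl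
    simp only [Matrix.mul_apply, Fintype.univ_unit, Finset.sum_singleton, Matrix.of_apply, star_eq_conjTranspose, Matrix.conjTranspose_apply, Complex.star_def, Matrix.one_apply_eq]
    exact chi_mul_conj K p b.1
  · exact Submonoid.one_mem _

/-- ★★ **CONSTANT FLUX**: the `(ν₀,ν₁)`-plaquette of `fluxLink p ν₁` at EVERY site equals `χ_p(e_{ν₀})·1` (`ν₀ ≠ ν₁`): `1·χ_p(x+e_{ν₀})·1·χ̄_p(x) = χ_p(e_{ν₀})`.
[cite: tHooft1979Flux, NPB 153 (flux sectors, notion); King1986, (2.12) p.653] -/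
theorem kingPlaq_fluxLink (p : Tor K) {ν₀ ν₁ : Fin (d + 1)} (hν : ν₀ ≠ ν₁) (x : Tor K) :
    kingPlaq K (fluxLink K p ν₁) x ν₀ ν₁ = Matrix.of (fun _ _ => chi K p (unitVec K ν₀)) := by
  ext i j
  obtain rfl : i = () := rfl; obtain rfl : j = () := rfl
  simp only [kingPlaq, fluxLink, hν, if_false, if_true, Matrix.one_mul]
  rw [Matrix.mul_apply]
  simp only [Fintype.univ_unit, Finset.sum_singleton, Matrix.mul_apply, Matrix.of_apply, Matrix.conjTranspose_apply, Matrix.one_apply_eq, Complex.star_def, map_one, mul_one]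
  rw [chi_add_right]
  calc chi K p x * chi K p (unitVec K ν₀) * conj (chi K p x) = chi K p (unitVec K ν₀) * (chi K p x * conj (chi K p x)) := by ring
    _ = chi K p (unitVec K ν₀) := by rw [chi_mul_conj, mul_one]

/-- `χ_p(e_ν) ≠ 1` as soon as `p_ν ≠ 0` (the standard additive character is injective). [folklore] -/
theorem chi_unitVec_ne_one {p : Tor K} {ν : Fin (d + 1)} (hp : p ν ≠ 0) : chi K p (unitVec K ν) ≠ 1 := by
  rw [chi_unitVec]
  intro h1
  apply hp
  have : (ZMod.stdAddChar (N := K ν)) (p ν) = (ZMod.stdAddChar (N := K ν)) 0 := by rw [h1, AddChar.map_zero_eq_one]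
  exact ZMod.injective_stdAddChar this

/-- The constant-flux field has a non-trivial plaquette (`p_{ν₀} ≠ 0`, `ν₀ ≠ ν₁`). [cite: tHooft1979Flux, NPB 153 (flux sectors, notion)] -/
theorem kingPlaq_fluxLink_ne_one {p : Tor K} {ν₀ ν₁ : Fin (d + 1)} (hν : ν₀ ≠ ν₁) (hp : p ν₀ ≠ 0) (x : Tor K) : kingPlaq K (fluxLink K p ν₁) x ν₀ ν₁ ≠ 1 := by
  rw [kingPlaq_fluxLink K p hν]
  intro h1
  have := congr_fun (congr_fun h1 ()) ()
  rw [Matrix.of_apply, Matrix.one_apply_eq] at this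
  exact chi_unitVec_ne_one K hp this

/-- ★★★ **CONSTANT FLUX IS OUTSIDE PART Ͻ's REACH**: for `p_{ν₀} ≠ 0`, `ν₀ ≠ ν₁`, on NO covering torus is the pulled-back constant-flux field a pure gauge (unitary `g`) — no cover
trivialises it, in contrast with every toron of finite-order holonomy (PART Ͻ-d). [cite: tHooft1979Flux, NPB 153 (flux sectors, notion); Balaban1985BackgroundPropagators, p.398 l.1–2] -/
theorem fluxLink_not_trivialised {K' : Fin (d + 1) → ℕ} (h : ∀ μ, K μ ∣ K' μ) {p : Tor K} {ν₀ ν₁ : Fin (d + 1)} (hν : ν₀ ≠ ν₁) (hp : p ν₀ ≠ 0)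
    {g : Tor K' → Matrix Unit Unit ℂ} (hg : ∀ y, g y ∈ Matrix.unitaryGroup Unit ℂ) :
    pullLink h (fluxLink K p ν₁) ≠ kingGaugeAct K' g (Hopping.free : Tor K' × Fin (d + 1) → Matrix Unit Unit ℂ) :=
  pullLink_ne_pureGauge_of_kingPlaq_ne_one h (kingPlaq_fluxLink_ne_one K hν hp 0) hg

end Summit.QuantumFields.YangMills.BalabanUVNodes.N15KingModelRung.Cover

end
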